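import Mathlib
import Summits.PneNP.PneNP.Theorems.ConvexRankGatesConvexGateBlindAffinePencilSixBounds

/-!
# PneNP / ConvexRankGates — `ConvexGateBlind`: the six-dimensional exclusion construction — validity on clique-free graphs

Helpers (`--supports stmt-PneNP-10680`), COLUMN-SPACE line (prover seat 2, session 26), PSD side; second file of
PROPOSITION L (memo ANALYSIS-seat2-s26 §2.3; data in `…AffinePencilSixData.lean`, bounds and the clique lemma in `…AffinePencilSixBounds.lean`). For `k ≥ 3`, `#S = k − 2` and every
`k`-clique-free graph `u`, the SOC data `(a(u); b(u))` of the construction lie in the Lorentz cone: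
`0 ≤ a(u)` and `Σᵢ b(u)ᵢ² ≤ a(u)²` (`six_pencil_soc_valid`). The four cases of the memo:

* a core edge missing — the core penalty `B` pays for everything (`dotNorm b ≤ A + L·#rims ≤ a`);
* core complete, no rim — `b = w(u)` is a spoke vector, `dotNorm w(u) ≤ A = a`;
* core complete, ≥ 2 rims — two DISTINCT unit normals lose `θ₀/2` of length against the budget's `L` per rim, and
  `L θ₀/2 ≥ Etot·C₁` absorbs the rim constants;
* core complete, exactly one rim `r = {x,y}` — the combinatorial heart: `u` clique-free ⟹ not all `2(k−2)` spokes from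
  `x, y` to `S` are present (`exists_missing_spoke`, else `S ∪ {x,y}` is a `k`-clique), so the spoke load seen by the normal
  of `r` is `⟨w(u), nvec r⟩ ≤ η_r(2 − 1/(k−2)) < κ η_r` (`wvec_dotProduct_nvec_le`), and the root-free expansion
  `⟨w + L n, w + L n⟩ = ⟨w,w⟩ + 2L⟨w,n⟩ + L²` stays below `(L + κη_r)²` because `L η_r ≥ (k−2)·A₂`.
[new]
-/

set_option linter.dupNamespace false

namespace Summit.PneNP.PneNP.Theorems

open Finset Real Matrix Literature.Computability.Complexity
open Summit.PneNP.PneNP.Cruxes.ConvexGateBlind.StrictRankConicCover (Edge cdist)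

noncomputable section

namespace SixPencil

variable {m : ℕ}

/-! ## The spoke load seen by the normal of a rim -/

/-- The spoke vector of a spoke is the moment vector of its outer endpoint. [folklore] -/
theorem spokeVec_eq_Uvec {S : Finset (Fin m)} {e : Edge m} (he : cls S e = 1) :
    ∃ v : Fin m, v ∈ edgeVerts e ∧ v ∉ S ∧ spokeVec S e = Uvec v := by
  have hcard : (edgeVerts e \ S).card = 1 := by
    have h := card_sdiff_add_card_inter (edgeVerts e) S
    rw [card_edgeVerts] at h; rw [cls] at he; omega
  obtain ⟨v, hv⟩ := card_eq_one.1 hcard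
  have hvmem : v ∈ edgeVerts e \ S := by rw [hv]; exact mem_singleton_self v
  refine ⟨v, (mem_sdiff.1 hvmem).1, (mem_sdiff.1 hvmem).2, ?_⟩
  rw [spokeVec, hv, sum_singleton]

/-- **The spoke load of a graph seen by the normal of the rim `r = {a,b}`** is at most `η_r (#spokes(a) + #spokes(b))/(k−2)`:
spokes ending at `a` or `b` are seen at height `η_r/(k−2)`, all other spokes at height `≤ 0`. [new] -/
theorem wvec_dotProduct_nvec_le {k : ℕ} (hk : 3 ≤ k) (S : Finset (Fin m)) {r : Edge m} {a b : Fin m} (hab : a ≠ b)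
    (hr : edgeVerts r = {a, b}) (u : Edge m → Bool) :
    wvec S k u ⬝ᵥ nvec r ≤ etaE r * ((spokesAt S u a).card + (spokesAt S u b).card) / ((k : ℝ) - 2) := by
  classical
  have hk2 : (0 : ℝ) < (k : ℝ) - 2 := by
    have : (3 : ℝ) ≤ k := by exact_mod_cast hk
    linarith
  have hη := (etaE_pos r).le
  rw [wvec, sum_dotProduct]
  -- termwise bound
  have hterm : ∀ e ∈ onCls S u 1, ((1 / ((k : ℝ) - 2)) • spokeVec S e) ⬝ᵥ nvec r ≤
      etaE r / ((k : ℝ) - 2) * ((if a ∈ edgeVerts e then 1 else 0) + (if b ∈ edgeVerts e then 1 else 0)) := by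
    intro e he
    simp only [onCls, mem_filter, mem_univ, true_and] at he
    obtain ⟨v, hve, hvS, hsv⟩ := spokeVec_eq_Uvec he.2
    rw [smul_dotProduct, hsv, smul_eq_mul]
    by_cases hvr : v ∈ edgeVerts r
    · rw [Uvec_dotProduct_nvec_of_mem hvr]
      have hind : (1 : ℝ) ≤ (if a ∈ edgeVerts e then 1 else 0) + (if b ∈ edgeVerts e then 1 else 0) := by
        rw [hr, mem_insert, mem_singleton] at hvr
        rcases hvr with rfl | rfl
        · rw [if_pos hve]; split_ifs <;> norm_num
        · rw [if_pos hve]; split_ifs <;> norm_num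
      have : etaE r / ((k : ℝ) - 2) * 1 ≤ etaE r / ((k : ℝ) - 2) *
          ((if a ∈ edgeVerts e then 1 else 0) + (if b ∈ edgeVerts e then 1 else 0)) :=
        mul_le_mul_of_nonneg_left hind (div_nonneg hη hk2.le)
      calc 1 / ((k : ℝ) - 2) * etaE r = etaE r / ((k : ℝ) - 2) * 1 := by ring
        _ ≤ _ := this
    · have hle := Uvec_dotProduct_nvec_of_not_mem hvr
      have h0 : (0 : ℝ) ≤ (if a ∈ edgeVerts e then 1 else 0) + (if b ∈ edgeVerts e then 1 else 0) := by
        split_ifs <;> norm_num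
      calc 1 / ((k : ℝ) - 2) * (Uvec v ⬝ᵥ nvec r) ≤ 0 :=
            mul_nonpos_of_nonneg_of_nonpos (div_nonneg one_pos.le hk2.le) hle
        _ ≤ _ := mul_nonneg (div_nonneg hη hk2.le) h0
  refine (Finset.sum_le_sum hterm).trans ?_
  rw [← Finset.mul_sum, Finset.sum_add_distrib, Finset.sum_boole, Finset.sum_boole]
  simp only [spokesAt]
  ring_nf
  rfl

/-! ## Common estimates -/

/-- `dotNorm (Σ_J nvec) ≤ #J`. [folklore] -/
theorem dotNorm_sum_nvec_le (J : Finset (Edge m)) : dotNorm (∑ e ∈ J, nvec e) ≤ J.card := by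
  refine (dotNorm_sum_le J _).trans ?_
  rw [Finset.sum_congr rfl fun e _ => dotNorm_eq_one_of_unit (nvec_unit e), sum_const, nsmul_eq_mul, mul_one]

/-- `Σ_J c_e ≥ −#J·C₁ ≥ −Etot·C₁`. [folklore] -/
theorem sum_cc_ge {k : ℕ} (hk : 3 ≤ k) (S : Finset (Fin m)) (J : Finset (Edge m)) :
    -(Etot m * C1 S k) ≤ ∑ e ∈ J, cc S k e := by
  have h1 : ∑ e ∈ J, -(C1 S k) ≤ ∑ e ∈ J, cc S k e :=
    Finset.sum_le_sum fun e _ => (abs_le.1 (abs_cc_le S hk e)).1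
  rw [sum_const, nsmul_eq_mul] at h1
  have hC1 : 0 ≤ C1 S k := by have := Abud_pos S k; rw [C1]; linarith
  have hJ := card_le_Etot J
  nlinarith

/-- Two distinct rim normals lose `θ₀/2` of length. [new] -/
theorem dotNorm_nvec_add_nvec_le (S : Finset (Fin m)) {e e' : Edge m} (he : cls S e = 0) (he' : cls S e' = 0)
    (hne : e ≠ e') : dotNorm (nvec e + nvec e') ≤ 2 - theta0 S / 2 := by
  have ht := theta0_le_two S
  have hdot := nvec_dot_le S he he' hne
  refine dotNorm_le_of_dotProduct_self_le_sq (by linarith) ?_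
  rw [add_dotProduct, dotProduct_add, dotProduct_add, nvec_unit, nvec_unit, dotProduct_comm (nvec e') (nvec e)]
  nlinarith [theta0_pos S]

/-! ## Validity -/

/-- **Case α — a core edge is missing**: the penalty `B` pays for everything. [new] -/
theorem soc_valid_core_missing {k : ℕ} (hk : 3 ≤ k) (S : Finset (Fin m)) (u : Edge m → Bool)
    (hmiss : (onCls S u 2).card < (cores S).card) :
    0 ≤ abud S k u ∧ dotNorm (bvec S k u) ≤ abud S k u := by
  set J := onCls S u 0 with hJ
  have hA := Abud_pos S k
  obtain ⟨hL1, -, -⟩ := Lbig_bounds S hk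
  have hE := Etot_nonneg m
  have hC1 : 0 ≤ C1 S k := by rw [C1]; linarith
  have hJc := card_le_Etot J
  have hJ0 : (0 : ℝ) ≤ J.card := Nat.cast_nonneg _
  have hcc := sum_cc_ge hk S J
  have hgap : (1 : ℝ) ≤ ((cores S).card : ℝ) - (onCls S u 2).card := by
    have : (onCls S u 2).card + 1 ≤ (cores S).card := hmiss
    have := (Nat.cast_le (α := ℝ)).2 this
    push_cast at this; linarith
  have hB : 0 ≤ Bbig S k := by
    rw [Bbig]; nlinarith
  -- the budget
  have ha : Abud S k + Bbig S k + Lbig S k * J.card - Etot m * C1 S k ≤ abud S k u := by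
    rw [abud_eq]
    have : Bbig S k * 1 ≤ Bbig S k * (((cores S).card : ℝ) - (onCls S u 2).card) :=
      mul_le_mul_of_nonneg_left hgap hB
    linarith
  -- the vector
  have hb : dotNorm (bvec S k u) ≤ Abud S k + Lbig S k * J.card := by
    rw [bvec_eq]
    refine (dotNorm_add_le _ _).trans ?_
    have h1 := dotNorm_wvec_le S hk u
    have h2 : dotNorm (Lbig S k • nsum S u) ≤ Lbig S k * J.card := by
      rw [dotNorm_smul_of_nonneg (by linarith)]
      exact mul_le_mul_of_nonneg_left (dotNorm_sum_nvec_le J) (by linarith)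
    linarith
  have hBE : Etot m * C1 S k ≤ Bbig S k := by
    rw [Bbig]; nlinarith
  constructor
  · nlinarith
  · linarith

/-- The core is complete when its count is full. [folklore] -/
theorem core_on_of_card_eq (S : Finset (Fin m)) (u : Edge m → Bool) (hfull : (onCls S u 2).card = (cores S).card) :
    ∀ e : Edge m, cls S e = 2 → u e = true := by
  have hsub : onCls S u 2 ⊆ cores S := by
    intro e he
    simp only [onCls, cores, mem_filter, mem_univ, true_and] at he ⊢; exact he.2
  have heq := Finset.eq_of_subset_of_card_le hsub hfull.ge
  intro e he
  have : e ∈ cores S := by simp only [cores, mem_filter, mem_univ, true_and]; exact he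
  rw [← heq] at this
  simp only [onCls, mem_filter, mem_univ, true_and] at this
  exact this.1

/-- **Case β₀/β₂ — core complete, no rim or at least two rims.** [new] -/
theorem soc_valid_core_full_ne_one {k : ℕ} (hk : 3 ≤ k) (S : Finset (Fin m)) (u : Edge m → Bool)
    (hfull : (onCls S u 2).card = (cores S).card) (hJ1 : (onCls S u 0).card ≠ 1) :
    0 ≤ abud S k u ∧ dotNorm (bvec S k u) ≤ abud S k u := by
  classical
  set J := onCls S u 0 with hJ
  have hA := Abud_pos S k
  obtain ⟨hL1, -, hL3⟩ := Lbig_bounds S hk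
  have hE := Etot_nonneg m
  have hC1 : 0 ≤ C1 S k := by rw [C1]; linarith
  have hθ := theta0_pos S
  have hcc := sum_cc_ge hk S J
  have ha : abud S k u = Abud S k + Lbig S k * J.card + ∑ e ∈ J, cc S k e := by
    rw [abud_eq, hfull]; ring
  have hw := dotNorm_wvec_le S hk u
  -- `Etot·C₁ ≤ L θ₀/2`
  have hLθ : Etot m * C1 S k ≤ Lbig S k * theta0 S / 2 := by
    have := (div_le_iff₀ hθ).1 hL3
    linarith
  rcases Nat.lt_or_ge J.card 2 with hlt | hge
  · -- no rim
    have hJ0 : J.card = 0 := by omega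
    have hJe : J = ∅ := card_eq_zero.1 hJ0
    have hb : bvec S k u = wvec S k u := by
      rw [bvec_eq, show nsum S u = 0 by rw [nsum, ← hJ, hJe, sum_empty], smul_zero, add_zero]
    rw [ha, hb, hJe, sum_empty, card_empty]
    simp only [Nat.cast_zero, mul_zero, add_zero]
    exact ⟨hA.le, hw⟩
  · -- at least two rims `r₁ ≠ r₂`
    obtain ⟨r₁, hr₁⟩ : J.Nonempty := card_pos.1 (by omega)
    have hcard₁ : (J.erase r₁).card = J.card - 1 := card_erase_of_mem hr₁
    obtain ⟨r₂, hr₂⟩ : (J.erase r₁).Nonempty := card_pos.1 (by omega)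
    have hr₂J := mem_of_mem_erase hr₂
    have hne : r₂ ≠ r₁ := ne_of_mem_erase hr₂
    have hcls₁ : cls S r₁ = 0 := by
      have := hr₁; simp only [hJ, onCls, mem_filter, mem_univ, true_and] at this; exact this.2
    have hcls₂ : cls S r₂ = 0 := by
      have := hr₂J; simp only [hJ, onCls, mem_filter, mem_univ, true_and] at this; exact this.2
    set J'' := (J.erase r₁).erase r₂ with hJ''
    have hcard'' : (J''.card : ℝ) = J.card - 2 := by
      have h1 : J''.card = (J.erase r₁).card - 1 := card_erase_of_mem hr₂
      have : J''.card + 2 = J.card := by omega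
      have := congrArg (fun n : ℕ => (n : ℝ)) this
      push_cast at this; linarith
    have hsplit : nsum S u = (nvec r₁ + nvec r₂) + ∑ e ∈ J'', nvec e := by
      rw [nsum, ← hJ, ← add_sum_erase J _ hr₁, ← add_sum_erase _ _ hr₂, add_assoc]
    have hns : dotNorm (nsum S u) ≤ J.card - theta0 S / 2 := by
      rw [hsplit]
      refine (dotNorm_add_le _ _).trans ?_
      have h1 := dotNorm_nvec_add_nvec_le S hcls₁ hcls₂ hne.symm
      have h2 := dotNorm_sum_nvec_le J''
      rw [hcard''] at h2
      linarith
    have hb : dotNorm (bvec S k u) ≤ Abud S k + Lbig S k * (J.card - theta0 S / 2) := by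
      rw [bvec_eq]
      refine (dotNorm_add_le _ _).trans ?_
      have h2 : dotNorm (Lbig S k • nsum S u) ≤ Lbig S k * (J.card - theta0 S / 2) := by
        rw [dotNorm_smul_of_nonneg (by linarith)]
        exact mul_le_mul_of_nonneg_left hns (by linarith)
      linarith
    have hJ2 : (2 : ℝ) ≤ J.card := by exact_mod_cast hge
    have ht2 := theta0_le_two S
    have hLJ : Lbig S k * theta0 S / 2 ≤ Lbig S k * J.card := by nlinarith
    constructor
    · rw [ha]; linarith
    · rw [ha]; nlinarith

/-- `√ν ≤ ν` (as `ν ≥ 1`). [folklore] -/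
theorem sqrt_nuE_le (e : Edge m) : Real.sqrt (nuE e) ≤ nuE e := by
  have h1 := one_le_sqrt_nuE e
  have h2 : Real.sqrt (nuE e) * Real.sqrt (nuE e) = nuE e :=
    Real.mul_self_sqrt (zero_le_one.trans (one_le_nuE e))
  nlinarith

/-- **Case β₁ — core complete, exactly one rim** (the combinatorial heart). [new] -/
theorem soc_valid_core_full_one {k : ℕ} (hk : 3 ≤ k) {S : Finset (Fin m)} (hS : S.card = k - 2)
    (u : Edge m → Bool) (hu : cliqueFn m k u = false)
    (hfull : (onCls S u 2).card = (cores S).card) (hJ1 : (onCls S u 0).card = 1) :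
    0 ≤ abud S k u ∧ ∑ i, bvec S k u i ^ 2 ≤ abud S k u ^ 2 := by
  classical
  obtain ⟨r, hJr⟩ := card_eq_one.1 hJ1
  have hrJ : r ∈ onCls S u 0 := by rw [hJr]; exact mem_singleton_self r
  have hr0 : u r = true ∧ cls S r = 0 := by
    simp only [onCls, mem_filter, mem_univ, true_and] at hrJ; exact hrJ
  -- endpoints of the rim lie outside `S`
  obtain ⟨a, b, hab, hr⟩ := exists_edgeVerts_eq_pair r
  have hdisj : edgeVerts r ∩ S = ∅ := card_eq_zero.1 hr0.2
  have ha : a ∉ S := fun h => by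
    have : a ∈ edgeVerts r ∩ S := mem_inter.2 ⟨by rw [hr]; simp, h⟩
    rw [hdisj] at this; exact absurd this (Finset.notMem_empty a)
  have hb : b ∉ S := fun h => by
    have : b ∈ edgeVerts r ∩ S := mem_inter.2 ⟨by rw [hr]; simp, h⟩
    rw [hdisj] at this; exact absurd this (Finset.notMem_empty b)
  have hreq : r = mkEdge hab := eq_mkEdge_of_edgeVerts_eq hab hr
  have hcore := core_on_of_card_eq S u hfull
  have hrim : u (mkEdge hab) = true := by rw [← hreq]; exact hr0.1
  -- the spoke count and the spoke load
  have hdeg := card_spokesAt_add_le hk hS ha hb hab hu hcore hrim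
  have hk3 : (3 : ℝ) ≤ k := by exact_mod_cast hk
  have hk2 : (0 : ℝ) < (k : ℝ) - 2 := by linarith
  have hdegR : ((spokesAt S u a).card : ℝ) + (spokesAt S u b).card ≤ 2 * ((k : ℝ) - 2) - 1 := by
    have h := (Nat.cast_le (α := ℝ)).2 hdeg
    push_cast at h
    have : ((k - 2 : ℕ) : ℝ) = (k : ℝ) - 2 := by
      rw [Nat.cast_sub (by omega)]; norm_num
    rw [this] at h; linarith
  have hη := etaE_pos r
  have hload : wvec S k u ⬝ᵥ nvec r ≤ etaE r * (2 - 1 / ((k : ℝ) - 2)) := by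
    refine (wvec_dotProduct_nvec_le hk S hab hr u).trans ?_
    rw [div_le_iff₀ hk2]
    have : etaE r * (2 - 1 / ((k : ℝ) - 2)) * ((k : ℝ) - 2) = etaE r * (2 * ((k : ℝ) - 2) - 1) := by
      field_simp
    rw [this]
    exact mul_le_mul_of_nonneg_left hdegR hη.le
  -- constants
  have hA2 := A2_nonneg S k
  obtain ⟨hL1, hL2, -⟩ := Lbig_bounds S hk
  obtain ⟨hκ1, hκ2⟩ := kap_bounds hk
  have hww := wvec_dotProduct_self_le S hk u
  -- `L η ≥ (k−2) A₂`
  have hLη : ((k : ℝ) - 2) * A2 S k ≤ Lbig S k * etaE r := by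
    have hs1 := one_le_sqrt_nuE r
    have hsν := sqrt_nuE_le r
    have hνt := nuE_le_nutot r
    have hpos : 0 < Real.sqrt (nuE r) := by linarith
    rw [etaE, mul_one_div, le_div_iff₀ hpos]
    calc ((k : ℝ) - 2) * A2 S k * Real.sqrt (nuE r) ≤ ((k : ℝ) - 2) * A2 S k * nutot m := by
          apply mul_le_mul_of_nonneg_left (hsν.trans hνt) (mul_nonneg hk2.le hA2)
      _ ≤ Lbig S k := hL2
  -- the data at `u`
  have haval : abud S k u = Lbig S k + kap k * etaE r := by
    rw [abud_eq, hfull, hJr, card_singleton, sum_singleton, cc]; push_cast; ring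
  have hbval : bvec S k u = wvec S k u + Lbig S k • nvec r := by
    rw [bvec_eq, nsum, hJr, sum_singleton]
  have hbb : bvec S k u ⬝ᵥ bvec S k u =
      wvec S k u ⬝ᵥ wvec S k u + 2 * Lbig S k * (wvec S k u ⬝ᵥ nvec r) + Lbig S k ^ 2 := by
    rw [hbval]; exact dotProduct_self_add_dir (nvec_unit r) _ _
  constructor
  · rw [haval]; nlinarith
  · rw [← dotProduct_self_eq_sum_sq, hbb, haval]
    -- `w⬝w + 2L(w⬝n) + L² ≤ (L + κη)²`
    have h1 : 2 * Lbig S k * (wvec S k u ⬝ᵥ nvec r) ≤ 2 * Lbig S k * (etaE r * (2 - 1 / ((k : ℝ) - 2))) :=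
      mul_le_mul_of_nonneg_left hload (by linarith)
    have hkap : kap k = 2 - 1 / (2 * ((k : ℝ) - 2)) := rfl
    have h2 : wvec S k u ⬝ᵥ wvec S k u ≤ Lbig S k * etaE r / ((k : ℝ) - 2) := by
      rw [le_div_iff₀ hk2]
      calc wvec S k u ⬝ᵥ wvec S k u * ((k : ℝ) - 2) ≤ A2 S k * ((k : ℝ) - 2) :=
            mul_le_mul_of_nonneg_right hww hk2.le
        _ ≤ Lbig S k * etaE r := by linarith
    have h3 : 2 * Lbig S k * (etaE r * (2 - 1 / ((k : ℝ) - 2))) + Lbig S k * etaE r / ((k : ℝ) - 2) =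
        2 * Lbig S k * (kap k * etaE r) := by
      rw [hkap]; field_simp; ring
    nlinarith [sq_nonneg (kap k * etaE r)]

/-- **Validity of the six-dimensional pencil**: for `k ≥ 3`, `#S = k−2` and every `k`-clique-free `u`, the SOC data lie in
the Lorentz cone: `0 ≤ a(u)` and `Σᵢ b(u)ᵢ² ≤ a(u)²`. [new] -/
theorem six_pencil_soc_valid {k : ℕ} (hk : 3 ≤ k) {S : Finset (Fin m)} (hS : S.card = k - 2)
    (u : Edge m → Bool) (hu : cliqueFn m k u = false) :
    0 ≤ abud S k u ∧ ∑ i, bvec S k u i ^ 2 ≤ abud S k u ^ 2 := by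
  have hsub : onCls S u 2 ⊆ cores S := by
    intro e he; simp only [onCls, cores, mem_filter, mem_univ, true_and] at he ⊢; exact he.2
  rcases (card_le_card hsub).lt_or_eq with hlt | hfull
  · obtain ⟨h0, h1⟩ := soc_valid_core_missing hk S u hlt
    exact ⟨h0, sum_sq_le_sq_of_dotNorm_le h1⟩
  · by_cases hJ1 : (onCls S u 0).card = 1
    · exact soc_valid_core_full_one hk hS u hu hfull hJ1
    · obtain ⟨h0, h1⟩ := soc_valid_core_full_ne_one hk S u hfull hJ1
      exact ⟨h0, sum_sq_le_sq_of_dotNorm_le h1⟩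


end SixPencil

/-- **Validity of the six-dimensional pencil** (registered form): for `k ≥ 3`, `#S = k − 2` and every `k`-clique-free
graph the SOC data of the construction lie in the Lorentz cone. [new] -/
theorem six_pencil_valid : ∀ {m k : ℕ}, 3 ≤ k → ∀ {S : Finset (Fin m)}, S.card = k - 2 → ∀ u : Edge m → Bool, cliqueFn m k u = false → 0 ≤ SixPencil.abud S k u ∧ ∑ i, SixPencil.bvec S k u i ^ 2 ≤ SixPencil.abud S k u ^ 2 :=
  fun hk _ hS u hu => SixPencil.six_pencil_soc_valid hk hS u hu

end

end Summit.PneNP.PneNP.Theorems
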